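import Literature.NumberTheory.EllipticCurves.HalfIntegralWeightThetaTransformation
import Literature.NumberTheory.EllipticCurves.HalfIntegralWeightGaussSumsTwo
import Literature.NumberTheory.EllipticCurves.TunnellHalfIntegralForms
import HarnessLib

/-!
# The theta multiplier on `θ(tz)`, `t ∣ 32`: `θ_t(γz) = ε_t(γ) j(γ, z) θ_t(z)` on `Γ₀(4t)`

Fourth file of the theta-multiplier chain (`HalfIntegralWeightGaussSums`,
`HalfIntegralWeightThetaTransformation` (★★), `HalfIntegralWeightGaussSumsOdd/Two`). For Tunnell's
`θ_t(z) = ∑_m e^{2πi t m² z}` (`Tunnell1983.thetaMul t`, which is `θ(tz)`, `thetaMul_eq_shimuraTheta`)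
and `γ = (a b; c d) ∈ SL₂(ℤ)` with `c > 0` we PROVE:

* `thetaMul_smul_of_four_dvd` — for `c = c' t` with `4 ∣ c'`:
  `θ_t(γz) = (2ic'/(cz + d))^{-1/2} G(a; c') θ_t(z)` ((★★) for `γ_t = (a, tb; c', d)` at the point
  `tz`, since `t · γz = γ_t (tz)`);
* the six cases used by Tunnell (p. 326: "`θ_t` is a modular form of weight `1/2`, level `4t` and
  character `χ_t`"): with `μ(γ, z) = (2ic/(cz + d))^{-1/2} G(a; c)` the multiplier of `θ` itself,
  `θ_t(γz) = μ(γ, z) θ_t(z)` for `t = 1, 4, 16` and `4t ∣ c` (`thetaMul_one/four/sixteen_smul`),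
  `θ_t(γz) = χ₈(a) μ(γ, z) θ_t(z)` for `t = 2, 8, 32` and `4t ∣ c` (`thetaMul_two/eight/thirtytwo_smul`);
  here `χ₈(a) = χ₈(d)` (`ad ≡ 1 (mod 8)`), the Kronecker symbol `(2/d) = χ_t(d)` for `t = 2, 8, 32`.

The inputs are the Gauss-sum identities `G(a; 4m) = 2 G(a; m)` (`4 ∣ m`) and
`G(a; 2m) = √2 χ₈(a) G(a; m)` (`4 ∣ m`), and `(X/t)^{1/2} = X^{1/2}/√t` (`cpow_half_div_natCast`).
Negative `c` and `c = 0` are left to the user (`-γ` acts as `γ`; translations).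

## References

* G. Shimura, *On modular forms of half integral weight*, Ann. of Math. 97 (1973), §1, Prop. 1.3–1.5 context.
* J. B. Tunnell, Invent. Math. 72 (1983), p. 326.
* N. Koblitz, *Introduction to Elliptic Curves and Modular Forms*, GTM 97 (1993), Ch. IV §1, Prop. 3 ff.
-/

noncomputable section

open scoped MatrixGroups

open UpperHalfPlane hiding I
open Complex Filter Topology

namespace Literature.NumberTheory.EllipticCurves.ModularForms

/-! ### A branch computation: `(X/t)^{1/2} = X^{1/2}/√t` -/

/-- For `X ≠ 0` and real `r > 0`, `(X / r)^{1/2} = X^{1/2} / √r` (principal branches: dividing by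
a positive real does not change the argument). [folklore] -/
theorem cpow_half_div_ofReal {X : ℂ} (hX : X ≠ 0) {r : ℝ} (hr : 0 < r) :
    (X / r) ^ (1 / 2 : ℂ) = X ^ (1 / 2 : ℂ) / (Real.sqrt r : ℂ) := by
  have hr0 : (r : ℂ) ≠ 0 := ofReal_ne_zero.mpr hr.ne'
  have hXr : X / r ≠ 0 := div_ne_zero hX hr0
  rw [cpow_def_of_ne_zero hXr, cpow_def_of_ne_zero hX,
    show X / r = ((r⁻¹ : ℝ) : ℂ) * X by push_cast; field_simp,
    Complex.log_ofReal_mul (inv_pos.mpr hr) hX, Real.log_inv, add_mul, Complex.exp_add,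
    mul_comm (Complex.exp _) _]
  congr 1
  have : Real.sqrt r = Real.exp (Real.log r * (1 / 2)) := by
    rw [Real.sqrt_eq_rpow, Real.rpow_def_of_pos hr]
  rw [this, Complex.ofReal_exp, ← Complex.exp_neg]
  congr 1
  push_cast
  ring

/-- `(X / t)^{1/2} = X^{1/2} / √t` for a natural number `t ≥ 1`. [folklore] -/
theorem cpow_half_div_natCast {X : ℂ} (hX : X ≠ 0) {t : ℕ} (ht : 0 < t) :
    (X / t) ^ (1 / 2 : ℂ) = X ^ (1 / 2 : ℂ) / (Real.sqrt t : ℂ) := by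
  have := cpow_half_div_ofReal hX (r := t) (by exact_mod_cast ht)
  exact_mod_cast this

/-- `√16 = 4` (real square root). [folklore] -/
theorem sqrt_sixteen : Real.sqrt 16 = 4 := by
  rw [show (16 : ℝ) = 4 ^ 2 by norm_num, Real.sqrt_sq (by norm_num)]

/-- `√8 = 2√2` (real square roots). [folklore] -/
theorem sqrt_eight : Real.sqrt 8 = 2 * Real.sqrt 2 := by
  rw [show (8 : ℝ) = 2 ^ 2 * 2 by norm_num, Real.sqrt_mul (by norm_num), Real.sqrt_sq zero_le_two]

/-- `√32 = 4√2` (real square roots). [folklore] -/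
theorem sqrt_thirtytwo : Real.sqrt 32 = 4 * Real.sqrt 2 := by
  rw [show (32 : ℝ) = 4 ^ 2 * 2 by norm_num, Real.sqrt_mul (by norm_num), Real.sqrt_sq (by norm_num)]

end Literature.NumberTheory.EllipticCurves.ModularForms

namespace Literature.NumberTheory.EllipticCurves.Tunnell1983

open Literature.NumberTheory.EllipticCurves.ModularForms

/-! ### `θ_t(z) = θ(tz)` -/

/-- `Im (t z) > 0` for `t ≥ 1`, `z ∈ ℍ`. [folklore] -/
theorem mul_im_pos {t : ℕ} (ht : 0 < t) (z : ℍ) : 0 < ((t : ℂ) * z).im := by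
  rw [Complex.mul_im, Complex.natCast_re, Complex.natCast_im, zero_mul, add_zero]
  exact mul_pos (by exact_mod_cast ht) z.im_pos

/-- **`θ_t(z) = θ(tz)`**: Tunnell's `thetaMul t` is Shimura's `θ` at the point `tz`. [folklore] -/
theorem thetaMul_eq_shimuraTheta {t : ℕ} (ht : 0 < t) (z : ℍ) :
    thetaMul t z = shimuraTheta (UpperHalfPlane.mk ((t : ℂ) * z) (mul_im_pos ht z)) := by
  rw [thetaMul, ← (hasSum_shimuraTheta (UpperHalfPlane.mk ((t : ℂ) * z) (mul_im_pos ht z))).tsum_eq]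
  refine tsum_congr fun m ↦ ?_
  have e : ((UpperHalfPlane.mk ((t : ℂ) * z) (mul_im_pos ht z) : ℍ) : ℂ) = (t : ℂ) * z := rfl
  rw [e]
  push_cast
  ring_nf

/-! ### `θ_t(γz)` for `c = c' t`, `4 ∣ c'` -/

/-- **`θ_t(γz) = (2ic'/(cz + d))^{-1/2} G(a; c') θ_t(z)`** for `γ = (a b; c d) ∈ SL₂(ℤ)` with
`c = c' t > 0` and `4 ∣ c'`: the transformation law (★★) of `θ` applied to
`γ_t = (a, tb; c', d) ∈ Γ₀(4)` at the point `tz`, using `t · γz = γ_t(tz)`.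
[cite: Shimura1973HalfIntegral, §1] [cite: Tunnell1983Congruent, p. 326] -/
theorem thetaMul_smul_of_four_dvd {γ : SL(2, ℤ)} {c' t : ℕ} [NeZero c'] (ht : 0 < t)
    (hc : (γ 1 0 : ℤ) = (c' : ℤ) * t) (h4 : 4 ∣ c') (z : ℍ) :
    thetaMul t (γ • z) =
      1 / (2 * I * c' / (((c' * t : ℕ) : ℂ) * z + γ 1 1)) ^ (1 / 2 : ℂ) *
        quadGaussSum c' (γ 0 0) 0 * thetaMul t z := by
  -- the matrix `γ_t`
  have hdet : (γ 0 0 : ℤ) * γ 1 1 - (t * γ 0 1) * c' = 1 := by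
    have := det_eq_one' γ
    rw [hc] at this
    linear_combination this
  set γt : SL(2, ℤ) := ⟨!![γ 0 0, t * γ 0 1; c', γ 1 1], by
    rw [Matrix.det_fin_two_of]; linear_combination hdet⟩ with hγt
  have e00 : (γt 0 0 : ℤ) = γ 0 0 := rfl
  have e01 : (γt 0 1 : ℤ) = t * γ 0 1 := rfl
  have e10 : (γt 1 0 : ℤ) = c' := rfl
  have e11 : (γt 1 1 : ℤ) = γ 1 1 := rfl
  -- `t · γz = γ_t (tz)`
  haveI : NeZero (c' * t) := ⟨by have := NeZero.ne c'; positivity⟩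
  have hw : ((c' : ℂ) * t) * z + ((γ 1 1 : ℤ) : ℂ) ≠ 0 := by
    have := im_denom_pos (c := c' * t) (γ 1 1) z
    push_cast at this
    intro h
    rw [h] at this
    simp at this
  have ez : ((UpperHalfPlane.mk ((t : ℂ) * z) (mul_im_pos ht z) : ℍ) : ℂ) = (t : ℂ) * z := rfl
  have eγz : ((UpperHalfPlane.mk ((t : ℂ) * ↑(γ • z)) (mul_im_pos ht (γ • z)) : ℍ) : ℂ) =
      (t : ℂ) * ↑(γ • z) := rfl
  have hpt : UpperHalfPlane.mk ((t : ℂ) * ↑(γ • z)) (mul_im_pos ht (γ • z)) =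
      γt • UpperHalfPlane.mk ((t : ℂ) * z) (mul_im_pos ht z) := by
    apply UpperHalfPlane.ext
    rw [eγz, coe_smul_eq' γt, ez, e00, e01, e10, e11, coe_smul_eq' γ, hc]
    push_cast
    have hw' : (c' : ℂ) * ((t : ℂ) * z) + ((γ 1 1 : ℤ) : ℂ) ≠ 0 := by
      rw [← mul_assoc]; exact hw
    field_simp
  rw [thetaMul_eq_shimuraTheta ht (γ • z), thetaMul_eq_shimuraTheta ht z, hpt,
    shimuraTheta_smul_eq_of_four_dvd (γ := γt) e10 h4, e00, e11, ez]
  push_cast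
  ring_nf

/-! ### The six cases `t ∣ 32` -/

section Cases

variable {γ : SL(2, ℤ)} {c : ℕ} [NeZero c]

/-- `2ic/(cz + d) ≠ 0` for `c ≥ 1`, `z ∈ ℍ`. [folklore] -/
theorem two_I_mul_div_denom_ne_zero (d : ℤ) (z : ℍ) :
    2 * I * (c : ℂ) / ((c : ℂ) * z + d) ≠ 0 := by
  have hw := im_denom_pos (c := c) d z
  have hw0 : (c : ℂ) * z + d ≠ 0 := by
    intro h; rw [h] at hw; simp at hw
  have hc0 : (c : ℂ) ≠ 0 := Nat.cast_ne_zero.mpr (NeZero.ne c)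
  exact div_ne_zero (mul_ne_zero (mul_ne_zero two_ne_zero I_ne_zero) hc0) hw0

omit [NeZero c] in
/-- `a` is odd when `c` is even (`ad - bc = 1`). [folklore] -/
theorem odd_entry_of_even (hc : (γ 1 0 : ℤ) = c) (h2 : 2 ∣ c) : Odd (γ 0 0 : ℤ) := by
  rw [← Int.not_even_iff_odd, even_iff_two_dvd]
  intro ha
  have h1 := det_eq_one' γ
  rw [hc] at h1
  have : (2 : ℤ) ∣ 1 := by
    rw [← h1]
    exact dvd_sub (ha.mul_right _) (Dvd.dvd.mul_left (by exact_mod_cast h2) _)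
  omega

omit [NeZero c] in
/-- `gcd(a, c) = 1` (`ad - bc = 1`). [folklore] -/
theorem gcd_entry_eq_one (hc : (γ 1 0 : ℤ) = c) : (γ 0 0 : ℤ).gcd c = 1 := by
  have h1 := det_eq_one' γ
  rw [hc] at h1
  exact Int.isCoprime_iff_gcd_eq_one.mp ⟨γ 1 1, -γ 0 1, by linear_combination h1⟩

/-- The general case rewritten with the multiplier of `θ`: for `c = c' t`, `4 ∣ c'`,
`θ_t(γz) = √t · G(a; c')/G-free… precisely
`θ_t(γz) = (√t G(a; c')) · (2ic/(cz + d))^{-1/2} θ_t(z)`. [folklore] -/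
theorem thetaMul_smul_of_four_dvd' {c' t : ℕ} [NeZero c'] (ht : 0 < t) (hc : (γ 1 0 : ℤ) = c)
    (hct : c = c' * t) (h4 : 4 ∣ c') (z : ℍ) :
    thetaMul t (γ • z) =
      (Real.sqrt t : ℂ) * quadGaussSum c' (γ 0 0) 0 *
        (1 / (2 * I * c / ((c : ℂ) * z + γ 1 1)) ^ (1 / 2 : ℂ)) * thetaMul t z := by
  have hc' : (γ 1 0 : ℤ) = (c' : ℤ) * t := by rw [hc, hct]; push_cast; ring
  rw [thetaMul_smul_of_four_dvd ht hc' h4 z, ← hct]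
  have hX := two_I_mul_div_denom_ne_zero (c := c) (γ 1 1) z
  have ht0 : (Real.sqrt t : ℂ) ≠ 0 := by
    exact_mod_cast (Real.sqrt_pos.mpr (by exact_mod_cast ht : (0 : ℝ) < t)).ne'
  have hkey : 2 * I * (c' : ℂ) / ((c : ℂ) * z + γ 1 1) =
      (2 * I * (c : ℂ) / ((c : ℂ) * z + γ 1 1)) / t := by
    rw [hct]; push_cast
    have : (t : ℂ) ≠ 0 := by exact_mod_cast ht.ne'
    field_simp
  rw [hkey, cpow_half_div_natCast hX ht]
  field_simp

/-- **`θ(4γz)`-type case `t = 4`**: for `16 ∣ c`, `θ₄(γz) = μ(γ, z) θ₄(z)` with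
`μ(γ, z) = (2ic/(cz + d))^{-1/2} G(a; c)` the multiplier of `θ` (as `√4 G(a; c/4) = G(a; c)`).
[cite: Tunnell1983Congruent, p. 326] -/
theorem thetaMul_four_smul (hc : (γ 1 0 : ℤ) = c) (h16 : 16 ∣ c) (z : ℍ) :
    thetaMul 4 (γ • z) =
      1 / (2 * I * c / ((c : ℂ) * z + γ 1 1)) ^ (1 / 2 : ℂ) * quadGaussSum c (γ 0 0) 0 *
        thetaMul 4 z := by
  obtain ⟨c', hc'⟩ : ∃ c', c = c' * 4 := by obtain ⟨q, hq⟩ := h16; exact ⟨4 * q, by omega⟩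
  haveI : NeZero c' := ⟨by rintro rfl; exact NeZero.ne c (by omega)⟩
  have h4 : 4 ∣ c' := by obtain ⟨q, hq⟩ := h16; exact ⟨q, by omega⟩
  have ha : Odd (γ 0 0 : ℤ) := odd_entry_of_even hc ⟨c' * 2, by omega⟩
  rw [thetaMul_smul_of_four_dvd' (by norm_num) hc hc' h4 z,
    quadGaussSum_four_mul' (c := c) (m := c') (by omega) h4 ha]
  rw [show ((4 : ℕ) : ℝ) = 2 ^ 2 by norm_num, Real.sqrt_sq zero_le_two]
  push_cast
  ring

/-- **Case `t = 1`** (this is (★★) itself, restated for `thetaMul 1`). [folklore] -/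
theorem thetaMul_one_smul (hc : (γ 1 0 : ℤ) = c) (h4 : 4 ∣ c) (z : ℍ) :
    thetaMul 1 (γ • z) =
      1 / (2 * I * c / ((c : ℂ) * z + γ 1 1)) ^ (1 / 2 : ℂ) * quadGaussSum c (γ 0 0) 0 *
        thetaMul 1 z := by
  rw [thetaMul_smul_of_four_dvd' (c' := c) (by norm_num) hc (by ring) h4 z, Nat.cast_one,
    Real.sqrt_one]
  push_cast
  ring

/-- **Case `t = 16`**: for `64 ∣ c`, `θ₁₆(γz) = μ(γ, z) θ₁₆(z)` (`√16 G(a; c/16) = G(a; c)` by two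
applications of `G(a; 4m) = 2 G(a; m)`). [cite: Tunnell1983Congruent, p. 326] -/
theorem thetaMul_sixteen_smul (hc : (γ 1 0 : ℤ) = c) (h64 : 64 ∣ c) (z : ℍ) :
    thetaMul 16 (γ • z) =
      1 / (2 * I * c / ((c : ℂ) * z + γ 1 1)) ^ (1 / 2 : ℂ) * quadGaussSum c (γ 0 0) 0 *
        thetaMul 16 z := by
  obtain ⟨q, hq⟩ := h64
  haveI : NeZero q := ⟨by rintro rfl; exact NeZero.ne c (by omega)⟩
  haveI : NeZero (4 * q) := ⟨by have := NeZero.ne q; positivity⟩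
  haveI : NeZero (16 * q) := ⟨by have := NeZero.ne q; positivity⟩
  have ha : Odd (γ 0 0 : ℤ) := odd_entry_of_even hc ⟨32 * q, by omega⟩
  rw [thetaMul_smul_of_four_dvd' (c' := 4 * q) (by norm_num) hc (by omega) (dvd_mul_right 4 q) z,
    quadGaussSum_four_mul' (c := c) (m := 16 * q) (by omega) ⟨4 * q, by ring⟩ ha,
    quadGaussSum_four_mul' (c := 16 * q) (m := 4 * q) (by ring) (dvd_mul_right 4 q) ha]
  rw [show ((16 : ℕ) : ℝ) = 16 by norm_num, sqrt_sixteen]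
  push_cast
  ring

/-- **Case `t = 2`**: for `8 ∣ c`, `θ₂(γz) = χ₈(a) μ(γ, z) θ₂(z)` (`√2 G(a; c/2) = χ₈(a) G(a; c)`
by `G(a; c) = √2 χ₈(a) G(a; c/2)`). [cite: Tunnell1983Congruent, p. 326] -/
theorem thetaMul_two_smul (hc : (γ 1 0 : ℤ) = c) (h8 : 8 ∣ c) (z : ℍ) :
    thetaMul 2 (γ • z) =
      ZMod.χ₈ (γ 0 0) *
        (1 / (2 * I * c / ((c : ℂ) * z + γ 1 1)) ^ (1 / 2 : ℂ) * quadGaussSum c (γ 0 0) 0) *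
          thetaMul 2 z := by
  obtain ⟨q, hq⟩ := h8
  haveI : NeZero q := ⟨by rintro rfl; exact NeZero.ne c (by omega)⟩
  haveI : NeZero (4 * q) := ⟨by have := NeZero.ne q; positivity⟩
  have ha : Odd (γ 0 0 : ℤ) := odd_entry_of_even hc ⟨4 * q, by omega⟩
  rw [thetaMul_smul_of_four_dvd' (c' := 4 * q) (by norm_num) hc (by omega) (dvd_mul_right 4 q) z,
    quadGaussSum_two_mul (c := c) (m := 4 * q) (by omega) (dvd_mul_right 4 q) (gcd_entry_eq_one hc)]
  rw [show ((2 : ℕ) : ℝ) = 2 by norm_num]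
  linear_combination (-((Real.sqrt 2 : ℂ) * quadGaussSum (4 * q) (γ 0 0 : ℤ) 0 *
    (1 / (2 * I * ↑c / (↑c * ↑z + ↑(γ 1 1))) ^ (1 / 2 : ℂ)) * thetaMul 2 z)) * χ₈_sq_of_odd ha

/-- **Case `t = 8`**: for `32 ∣ c`, `θ₈(γz) = χ₈(a) μ(γ, z) θ₈(z)` (`√8 G(a; c/8) = 2√2 G(a; c/8)`,
`G(a; c) = 2 G(a; c/4) = 2√2 χ₈(a) G(a; c/8)`). [cite: Tunnell1983Congruent, p. 326] -/
theorem thetaMul_eight_smul (hc : (γ 1 0 : ℤ) = c) (h32 : 32 ∣ c) (z : ℍ) :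
    thetaMul 8 (γ • z) =
      ZMod.χ₈ (γ 0 0) *
        (1 / (2 * I * c / ((c : ℂ) * z + γ 1 1)) ^ (1 / 2 : ℂ) * quadGaussSum c (γ 0 0) 0) *
          thetaMul 8 z := by
  obtain ⟨q, hq⟩ := h32
  haveI : NeZero q := ⟨by rintro rfl; exact NeZero.ne c (by omega)⟩
  haveI : NeZero (4 * q) := ⟨by have := NeZero.ne q; positivity⟩
  haveI : NeZero (8 * q) := ⟨by have := NeZero.ne q; positivity⟩
  have ha : Odd (γ 0 0 : ℤ) := odd_entry_of_even hc ⟨16 * q, by omega⟩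
  have hgcd : (γ 0 0 : ℤ).gcd (8 * q : ℕ) = 1 := by
    have h := Int.isCoprime_iff_gcd_eq_one.mpr (gcd_entry_eq_one hc)
    rw [hq] at h
    push_cast at h
    rw [show (32 : ℤ) * q = 4 * (8 * q) by ring] at h
    have := h.of_mul_right_right
    exact Int.isCoprime_iff_gcd_eq_one.mp (by exact_mod_cast this)
  rw [thetaMul_smul_of_four_dvd' (c' := 4 * q) (by norm_num) hc (by omega) (dvd_mul_right 4 q) z,
    quadGaussSum_four_mul' (c := c) (m := 8 * q) (by omega) ⟨2 * q, by ring⟩ ha,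
    quadGaussSum_two_mul (c := 8 * q) (m := 4 * q) (by ring) (dvd_mul_right 4 q) hgcd]
  rw [show ((8 : ℕ) : ℝ) = 8 by norm_num, sqrt_eight]
  push_cast
  linear_combination (-(2 * (Real.sqrt 2 : ℂ) * quadGaussSum (4 * q) (γ 0 0 : ℤ) 0 *
    (1 / (2 * I * ↑c / (↑c * ↑z + ↑(γ 1 1))) ^ (1 / 2 : ℂ)) * thetaMul 8 z)) * χ₈_sq_of_odd ha

/-- **Case `t = 32`**: for `128 ∣ c`, `θ₃₂(γz) = χ₈(a) μ(γ, z) θ₃₂(z)`.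
[cite: Tunnell1983Congruent, p. 326] -/
theorem thetaMul_thirtytwo_smul (hc : (γ 1 0 : ℤ) = c) (h128 : 128 ∣ c) (z : ℍ) :
    thetaMul 32 (γ • z) =
      ZMod.χ₈ (γ 0 0) *
        (1 / (2 * I * c / ((c : ℂ) * z + γ 1 1)) ^ (1 / 2 : ℂ) * quadGaussSum c (γ 0 0) 0) *
          thetaMul 32 z := by
  obtain ⟨q, hq⟩ := h128
  haveI : NeZero q := ⟨by rintro rfl; exact NeZero.ne c (by omega)⟩
  haveI : NeZero (4 * q) := ⟨by have := NeZero.ne q; positivity⟩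
  haveI : NeZero (8 * q) := ⟨by have := NeZero.ne q; positivity⟩
  haveI : NeZero (32 * q) := ⟨by have := NeZero.ne q; positivity⟩
  have ha : Odd (γ 0 0 : ℤ) := odd_entry_of_even hc ⟨64 * q, by omega⟩
  have hgcd : (γ 0 0 : ℤ).gcd (8 * q : ℕ) = 1 := by
    have h := Int.isCoprime_iff_gcd_eq_one.mpr (gcd_entry_eq_one hc)
    rw [hq] at h
    push_cast at h
    rw [show (128 : ℤ) * q = 16 * (8 * q) by ring] at h
    have := h.of_mul_right_right
    exact Int.isCoprime_iff_gcd_eq_one.mp (by exact_mod_cast this)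
  rw [thetaMul_smul_of_four_dvd' (c' := 4 * q) (by norm_num) hc (by omega) (dvd_mul_right 4 q) z,
    quadGaussSum_four_mul' (c := c) (m := 32 * q) (by omega) ⟨8 * q, by ring⟩ ha,
    quadGaussSum_four_mul' (c := 32 * q) (m := 8 * q) (by ring) ⟨2 * q, by ring⟩ ha,
    quadGaussSum_two_mul (c := 8 * q) (m := 4 * q) (by ring) (dvd_mul_right 4 q) hgcd]
  rw [show ((32 : ℕ) : ℝ) = 32 by norm_num, sqrt_thirtytwo]
  push_cast
  linear_combination (-(4 * (Real.sqrt 2 : ℂ) * quadGaussSum (4 * q) (γ 0 0 : ℤ) 0 *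
    (1 / (2 * I * ↑c / (↑c * ↑z + ↑(γ 1 1))) ^ (1 / 2 : ℂ)) * thetaMul 32 z)) * χ₈_sq_of_odd ha

end Cases

end Literature.NumberTheory.EllipticCurves.Tunnell1983
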